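import Literature.Analysis.FluidPDE.CLPerturbation
import Literature.Analysis.FluidPDE.EulerReynoldsMollification
import Literature.Analysis.FluidPDE.OscillatoryExpansion
import HarnessLib

/-!
# Cheskidov–Luo convex integration: the new Reynolds stress (stress algebra, CL22 Lemma 4.5)

Analysis/FluidPDE support file (all results proved; definitions are explicit constructions) for
the proof of Prop. 4.1 of A. Cheskidov, X. Luo, *Sharp nonuniqueness for the Navier–Stokes
equations*, Invent. Math. 229 (2022) = arXiv:2009.06596, §4.5 (numbering of the held arXiv copy).
For the perturbation `w = w^{(p)} + w^{(c)} + w^{(t)}` of `CLPerturbation` (data `D : CL22.Datum d`)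
it produces explicit jointly smooth fields — a symmetric tensor `D.S₁`, a scalar `D.qq` and a
vector field `D.ff` — with

  `∂ₜw + div (w ⊗ w) + div R = div S₁ + ∇qq + ff`   on `[0, T] × 𝕋^d`   (`momentum_identity`),

the input of the abstract step `IsNSReynoldsOn.perturb` (`NSRPerturbation`). This is CL22 Lemma 4.5
(`div(w^{(p)} ⊗ w^{(p)} + R̄) + ∂ₜw^{(t)} + ∇P = div(R_{osc,x} + R_{osc,t} + R_far)`) together with
the linear part `∂ₜ(w^{(p)} + w^{(c)})` of `R_lin` (Lemma 4.6), in the Calderón–Zygmund-free form of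
this series:

* `R_far = 0` (one time profile per direction), and the oscillation term
  `∑_x (ψ_x² - 1)(σ·) ((k_x·∇)a_x²) k_x` is expanded once with the potential `oscPot`
  (`Δ oscPot = ψ_x(σ·)² - 1`) by the symmetric expansion `(ΔΦ)c = div S - ∇π - r` of
  `OscillatoryExpansion` (atom `C`), instead of the bilinear antidivergence `𝓑` of Thm. 7.4;
* `∂ₜw^{(p)} = ∑_x (G_x'ã_x + G_x∂ₜã_x)ψ_x(σ·)k_x`: the large term `G_x'ã_xψ_x(σ·)k_x = (ΔP_x)c^A_x`
  is expanded with `P_x = σ⁻²φ_x(σ·)` (atom `A`); its remainder combines with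
  `∂ₜw^{(c)} ∋ G_x'Ω̃_x[∇ã_x]` to `-2G_x'((k_x·∇)ã_x)∇P_x = ∑ⱼ (Δ thetaRⱼ) c^B_{x,j}`, expanded once
  more with the second-layer potentials `thetaR` (atoms `B`);
* the cancellation of Lemma 4.5: `∂ₜw^{(t)} + ∑_x (G_x² - 1)θ² div B̂_x = ∑_x (G_x² - 1)θ² ∇q̂_x - …`
  (`H_x' = G_x² - 1`), and Lemma 4.4 in the form `∑_x θ² div B̂_x = ∇(θ²ρ) - div R`
  (`CL22.sum_amp_sq_mul_dir`, `θ²R = R`);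
* everything small (terms carrying `G_x∂ₜã_x`, `Ω̃_x[∂ₜ∇ã_x]`, `H_x`, and the expansion
  remainders of the atoms `B`, `C`) is collected in `ff`, all pressures in `qq`, all symmetric
  tensors (including `w ⊗ w - w^{(p)} ⊗ w^{(p)}`) in `S₁`.

Also: joint smoothness of `S₁`, `qq`, `ff`, symmetry of `S₁`, and their vanishing at times where
`θ = θ' = 0`.

## References

* A. Cheskidov, X. Luo, arXiv:2009.06596, §4.4 Lemma 4.4, §4.5 Lemmas 4.5–4.6, (4.20)–(4.24).
  [`CheskidovLuo2022`]
-/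

noncomputable section

open Set Filter Topology Function MeasureTheory Finset
open scoped ContDiff ENNReal InnerProductSpace

namespace Literature.Analysis.FluidPDE

namespace CL22

open FunctionSpaces NashGeometric Mikado Intermittent

variable {d : Type*} [Fintype d] [DecidableEq d]

namespace Datum

variable (D : Datum d)

/-! ## The atoms of the expansion and the fields `S₁`, `qq`, `ff` -/

/-- Atom `A`: the coefficient `c^A_x = G_x' ã_x k_x` of `G_x'ã_xψ_x(σ·)k_x = (ΔP_x) c^A_x`. [folklore] -/
def cA (x : Index d) (t : ℝ) (y : UnitAddTorus d) : EuclideanSpace ℝ d := (D.dG x t * D.atil x t y) • dirVec x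

/-- Atoms `B`: the coefficients `c^B_{x,j} = -2G_x'((k_x·∇)ã_x) eⱼ` of
`-2G_x'((k_x·∇)ã_x)∇P_x = ∑ⱼ (Δ thetaR_j) c^B_{x,j}`. [folklore] -/
def cB (x : Index d) (t : ℝ) (j : d) (y : UnitAddTorus d) : EuclideanSpace ℝ d :=
  (-2 * D.dG x t * dirD x (D.atil x t) y) • EuclideanSpace.single j 1

/-- Atom `C`: the coefficient `c^C_x = G_x²((k_x·∇)ã_x²) k_x` of the oscillation term
`(ψ_x² - 1)(σ·)((k_x·∇)a_x²)k_x = (Δ oscPot_x) c^C_x` (CL22 (4.22)). [cite: CheskidovLuo2022, §4.5 (4.22)] -/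
def cC (x : Index d) (t : ℝ) (y : UnitAddTorus d) : EuclideanSpace ℝ d :=
  (D.G x t ^ 2 * dirD x (fun z => D.atil x t z ^ 2) y) • dirVec x

/-- The second-layer potentials `Φ^B_{x,j} = σ⁻³(∂ⱼΘ_x)(σ·)`. [folklore] -/
def ΦB (x : Index d) (j : d) : UnitAddTorus d → ℝ := thetaR x D.μ D.σ j

/-- The oscillation potential `Φ^C_x = σ⁻²(Δ⁻¹(ψ_x² - 1))(σ·)`. [folklore] -/
def ΦC (x : Index d) : UnitAddTorus d → ℝ := oscPot x D.μ D.σ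

/-- The expansion tensors of all atoms of direction `x` (by columns). [folklore] -/
def Sexp (x : Index d) (t : ℝ) (y : UnitAddTorus d) (j : d) : EuclideanSpace ℝ d :=
  Torus.expansionTensor (D.cA x t) (D.P x) y j + ∑ j', Torus.expansionTensor (D.cB x t j') (D.ΦB x j') y j +
    Torus.expansionTensor (D.cC x t) (D.ΦC x) y j

/-- The expansion pressures of all atoms of direction `x`. [folklore] -/
def πexp (x : Index d) (t : ℝ) (y : UnitAddTorus d) : ℝ :=
  Torus.expansionPressure (D.cA x t) (D.P x) y + ∑ j', Torus.expansionPressure (D.cB x t j') (D.ΦB x j') y +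
    Torus.expansionPressure (D.cC x t) (D.ΦC x) y

/-- The expansion remainders of the atoms `B`, `C` of direction `x` (the remainder of atom `A` is
absorbed into the atoms `B`). [folklore] -/
def rexp (x : Index d) (t : ℝ) (y : UnitAddTorus d) : EuclideanSpace ℝ d :=
  ∑ j', Torus.expansionRemainder (D.cB x t j') (D.ΦB x j') y + Torus.expansionRemainder (D.cC x t) (D.ΦC x) y

/-- **The explicit symmetric tensor** `S₁ = (w ⊗ w - w^{(p)} ⊗ w^{(p)}) + ∑_x Sexp_x` (by columns). [cite: CheskidovLuo2022, §4.5 Lemma 4.5] -/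
def S₁ (t : ℝ) (y : UnitAddTorus d) (j : d) : EuclideanSpace ℝ d :=
  (Torus.tensorProd (D.w t) (D.w t) y j - Torus.tensorProd (D.wp t) (D.wp t) y j) + ∑ x, D.Sexp x t y j

/-- **The explicit pressure** `qq = θ²ρ + ∑_x (G_x² - 1)θ² q̂_x - ∑_x πexp_x` (CL22 (4.24): `P = θ²g̃²ρ - ν⁻¹h Δ⁻¹div div R̄`). [cite: CheskidovLuo2022, §4.5 (4.24)] -/
def qq (t : ℝ) (y : UnitAddTorus d) : ℝ :=
  D.θ t ^ 2 * divisor D.γ₀ D.R t y + ∑ x, (D.G x t ^ 2 - 1) * D.θ t ^ 2 * D.qhat x t y - ∑ x, D.πexp x t y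

/-- **The explicit remainder** `ff` (everything routed through the antidivergence `ℛ`):
`∑_x (G_x ∂ₜã_x ψ_x(σ·)) k_x + ∑_x G_x Ω̃_x[∂ₜ∇ã_x] - ∑_x (H_xθ² ∂ₜZ_x + H_x(θ²)' Z_x) - ∑_x rexp_x`. [cite: CheskidovLuo2022, §4.5 Lemma 4.5] -/
def ff (t : ℝ) (y : UnitAddTorus d) : EuclideanSpace ℝ d :=
  ∑ x, (D.G x t * Torus.timeDerivWithin (Icc 0 D.T) (D.atil x) t y * D.Ψ x y) • dirVec x +
    ∑ x, D.G x t • D.omegaApply x y (Torus.timeDerivWithin (Icc 0 D.T) (D.gradA x) t y) -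
    ∑ x, ((D.H x t * D.θ t ^ 2) • Torus.timeDerivWithin (Icc 0 D.T) (D.Z x) t y +
      (D.H x t * deriv (fun s => D.θ s ^ 2) t) • D.Z x t y) -
    ∑ x, D.rexp x t y

/-! ## Smoothness -/

section Smooth

variable {D} (h : D.Valid)
include h

/-- `(k_x·∇)f` of a jointly smooth scalar is jointly smooth. [folklore] -/
theorem smooth_dirD (x : Index d) {f : ℝ → UnitAddTorus d → ℝ} (hf : Torus.IsSmoothSpaceTimeOn (Icc 0 D.T) f) :
    Torus.IsSmoothSpaceTimeOn (Icc 0 D.T) (fun t y => dirD x (f t) y) :=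
  Torus.IsSmoothSpaceTimeOn.sum fun j _ =>
    (Torus.isSmoothSpaceTimeOn_const (Torus.isSmooth_const _) _).mul (hf.partialDeriv (uniqueDiffOn h) j)

/-- `c^A_x` is jointly smooth. [folklore] -/
theorem smooth_cA (x : Index d) : Torus.IsSmoothSpaceTimeOn (Icc 0 D.T) (D.cA x) :=
  ((smooth_atil h x).time_smul (contDiff_dG h x).contDiffOn).smul (Torus.isSmoothSpaceTimeOn_const (Torus.isSmooth_const _) _)

/-- `c^B_{x,j}` is jointly smooth. [folklore] -/
theorem smooth_cB (x : Index d) (j : d) : Torus.IsSmoothSpaceTimeOn (Icc 0 D.T) (fun t => D.cB x t j) := by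
  have h1 : Torus.IsSmoothSpaceTimeOn (Icc 0 D.T) (fun t y => -2 * D.dG x t * dirD x (D.atil x t) y) :=
    (smooth_dirD h x (smooth_atil h x)).time_smul ((contDiff_const.mul (contDiff_dG h x)).contDiffOn)
  exact h1.smul (Torus.isSmoothSpaceTimeOn_const (Torus.isSmooth_const _) _)

/-- `c^C_x` is jointly smooth. [folklore] -/
theorem smooth_cC (x : Index d) : Torus.IsSmoothSpaceTimeOn (Icc 0 D.T) (D.cC x) := by
  have h1 : Torus.IsSmoothSpaceTimeOn (Icc 0 D.T) (fun t y => D.atil x t y ^ 2) := (smooth_atil h x).pow 2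
  exact ((smooth_dirD h x h1).time_smul ((contDiff_G h x).pow 2).contDiffOn).smul
    (Torus.isSmoothSpaceTimeOn_const (Torus.isSmooth_const _) _)

/-- `Φ^B_{x,j}` is smooth. [folklore] -/
theorem isSmooth_ΦB (x : Index d) (j : d) : Torus.IsSmooth (D.ΦB x j) := isSmooth_thetaR x h.hμ D.σ j

/-- `Φ^C_x` is smooth. [folklore] -/
theorem isSmooth_ΦC (x : Index d) : Torus.IsSmooth (D.ΦC x) := isSmooth_oscPot x h.hμ D.σ

omit h in
/-- Expansion tensors of jointly smooth coefficients against a fixed smooth potential are jointly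
smooth. [folklore] -/
theorem smooth_expansionTensor {S : Set ℝ} {c : ℝ → UnitAddTorus d → EuclideanSpace ℝ d}
    (hc : Torus.IsSmoothSpaceTimeOn S c) {Φ : UnitAddTorus d → ℝ} (hΦ : Torus.IsSmooth Φ) :
    Torus.IsSmoothSpaceTimeOn S (fun t => Torus.expansionTensor (c t) Φ) :=
  Torus.isSmoothSpaceTimeOn_of_columns fun j =>
    ((Torus.isSmoothSpaceTimeOn_const (hΦ.partialDeriv j) S).smul hc).add
      ((hc.apply j).smul (Torus.isSmoothSpaceTimeOn_const hΦ.gradient S))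

omit [DecidableEq d] h in
/-- Expansion pressures of jointly smooth coefficients against a fixed smooth potential are jointly
smooth. [folklore] -/
theorem smooth_expansionPressure {S : Set ℝ} {c : ℝ → UnitAddTorus d → EuclideanSpace ℝ d}
    (hc : Torus.IsSmoothSpaceTimeOn S c) {Φ : UnitAddTorus d → ℝ} (hΦ : Torus.IsSmooth Φ) :
    Torus.IsSmoothSpaceTimeOn S (fun t => Torus.expansionPressure (c t) Φ) :=
  hc.inner (Torus.isSmoothSpaceTimeOn_const hΦ.gradient S)

omit h in
/-- Expansion remainders of jointly smooth coefficients against a fixed smooth potential are jointly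
smooth. [folklore] -/
theorem smooth_expansionRemainder {S : Set ℝ} (hS : UniqueDiffOn ℝ S) {c : ℝ → UnitAddTorus d → EuclideanSpace ℝ d}
    (hc : Torus.IsSmoothSpaceTimeOn S c) {Φ : UnitAddTorus d → ℝ} (hΦ : Torus.IsSmooth Φ) :
    Torus.IsSmoothSpaceTimeOn S (fun t => Torus.expansionRemainder (c t) Φ) := by
  refine Torus.IsSmoothSpaceTimeOn.sub (Torus.IsSmoothSpaceTimeOn.add ?_ ?_) ?_
  · exact Torus.IsSmoothSpaceTimeOn.sum fun j _ =>
      (Torus.isSmoothSpaceTimeOn_const (hΦ.partialDeriv j) S).smul (hc.partialDeriv hS j)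
  · exact (hc.divergence hS).smul (Torus.isSmoothSpaceTimeOn_const hΦ.gradient S)
  · exact Torus.IsSmoothSpaceTimeOn.sum fun j _ =>
      (Torus.isSmoothSpaceTimeOn_const (hΦ.gradient.apply j) S).smul ((hc.apply j).gradient hS)

/-- `Sexp_x` is jointly smooth. [folklore] -/
theorem smooth_Sexp (x : Index d) : Torus.IsSmoothSpaceTimeOn (Icc 0 D.T) (D.Sexp x) := by
  have hA := smooth_expansionTensor (smooth_cA h x) (isSmooth_P h x)
  have hB : ∀ j', Torus.IsSmoothSpaceTimeOn (Icc 0 D.T) (fun t => Torus.expansionTensor (D.cB x t j') (D.ΦB x j')) :=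
    fun j' => smooth_expansionTensor (smooth_cB h x j') (isSmooth_ΦB h x j')
  have hC := smooth_expansionTensor (smooth_cC h x) (isSmooth_ΦC h x)
  refine Torus.isSmoothSpaceTimeOn_of_columns fun j => ?_
  exact (((hA.column j)).add
    (Torus.IsSmoothSpaceTimeOn.sum fun j' _ => ((hB j').column j))).add
      ((hC.column j))

/-- `πexp_x` is jointly smooth. [folklore] -/
theorem smooth_πexp (x : Index d) : Torus.IsSmoothSpaceTimeOn (Icc 0 D.T) (D.πexp x) :=
  ((smooth_expansionPressure (smooth_cA h x) (isSmooth_P h x)).add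
    (Torus.IsSmoothSpaceTimeOn.sum fun j' _ => smooth_expansionPressure (smooth_cB h x j') (isSmooth_ΦB h x j'))).add
      (smooth_expansionPressure (smooth_cC h x) (isSmooth_ΦC h x))

/-- `rexp_x` is jointly smooth. [folklore] -/
theorem smooth_rexp (x : Index d) : Torus.IsSmoothSpaceTimeOn (Icc 0 D.T) (D.rexp x) :=
  (Torus.IsSmoothSpaceTimeOn.sum fun j' _ => smooth_expansionRemainder (uniqueDiffOn h) (smooth_cB h x j') (isSmooth_ΦB h x j')).add
    (smooth_expansionRemainder (uniqueDiffOn h) (smooth_cC h x) (isSmooth_ΦC h x))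

/-- **`S₁` is jointly smooth on `[0, T]`**. [folklore] -/
theorem smooth_S₁ : Torus.IsSmoothSpaceTimeOn (Icc 0 D.T) D.S₁ := by
  have h1 := ((smooth_w h).tensorProd (smooth_w h)).sub ((smooth_wp h).tensorProd (smooth_wp h))
  have h2 : Torus.IsSmoothSpaceTimeOn (Icc 0 D.T) (fun t y j => ∑ x, D.Sexp x t y j) :=
    Torus.isSmoothSpaceTimeOn_of_columns fun j =>
      Torus.IsSmoothSpaceTimeOn.sum fun x _ => ((smooth_Sexp h x).column j)
  exact Torus.isSmoothSpaceTimeOn_of_columns fun j =>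
    ((h1.column j)).add ((h2.column j))

/-- **`qq` is jointly smooth on `[0, T]`**. [folklore] -/
theorem smooth_qq : Torus.IsSmoothSpaceTimeOn (Icc 0 D.T) D.qq := by
  have h1 : Torus.IsSmoothSpaceTimeOn (Icc 0 D.T) (fun t y => D.θ t ^ 2 * divisor D.γ₀ D.R t y) :=
    (isSmoothSpaceTimeOn_divisor h.hR).time_smul (h.hθ.pow 2).contDiffOn
  have h2 : Torus.IsSmoothSpaceTimeOn (Icc 0 D.T) (fun t y => ∑ x, (D.G x t ^ 2 - 1) * D.θ t ^ 2 * D.qhat x t y) :=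
    Torus.IsSmoothSpaceTimeOn.sum fun x _ =>
      (smooth_qhat h x).time_smul ((((contDiff_G h x).pow 2).sub contDiff_const).mul (h.hθ.pow 2)).contDiffOn
  exact (h1.add h2).sub (Torus.IsSmoothSpaceTimeOn.sum fun x _ => smooth_πexp h x)

omit [Fintype d] [DecidableEq d] h in
/-- `(θ²)'` is smooth. [folklore] -/
theorem contDiff_deriv_thetaSq (hθ : ContDiff ℝ ∞ D.θ) : ContDiff ℝ ∞ (deriv fun s => D.θ s ^ 2) :=
  (contDiff_infty_iff_deriv.1 (hθ.pow 2)).2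

/-- **`ff` is jointly smooth on `[0, T]`**. [folklore] -/
theorem smooth_ff : Torus.IsSmoothSpaceTimeOn (Icc 0 D.T) D.ff := by
  have hU := uniqueDiffOn h
  have h1 : Torus.IsSmoothSpaceTimeOn (Icc 0 D.T) (fun t y => ∑ x, (D.G x t * Torus.timeDerivWithin (Icc 0 D.T) (D.atil x) t y *
      D.Ψ x y) • dirVec x) :=
    Torus.IsSmoothSpaceTimeOn.sum fun x _ =>
      ((((smooth_atil h x).timeDerivWithin hU).time_smul (contDiff_G h x).contDiffOn).mul
        (Torus.isSmoothSpaceTimeOn_const (isSmooth_Ψ h x) _)).smul (Torus.isSmoothSpaceTimeOn_const (Torus.isSmooth_const _) _)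
  have h2 : Torus.IsSmoothSpaceTimeOn (Icc 0 D.T) (fun t y => ∑ x, D.G x t • D.omegaApply x y
      (Torus.timeDerivWithin (Icc 0 D.T) (D.gradA x) t y)) :=
    Torus.IsSmoothSpaceTimeOn.sum fun x _ =>
      (smooth_omegaApply h x ((smooth_gradA h x).timeDerivWithin hU)).time_smul (contDiff_G h x).contDiffOn
  have h3 : Torus.IsSmoothSpaceTimeOn (Icc 0 D.T) (fun t y => ∑ x, ((D.H x t * D.θ t ^ 2) •
      Torus.timeDerivWithin (Icc 0 D.T) (D.Z x) t y + (D.H x t * deriv (fun s => D.θ s ^ 2) t) • D.Z x t y)) :=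
    Torus.IsSmoothSpaceTimeOn.sum fun x _ =>
      (((smooth_Z h x).timeDerivWithin hU).time_smul ((contDiff_H h x).mul (h.hθ.pow 2)).contDiffOn).add
        ((smooth_Z h x).time_smul ((contDiff_H h x).mul (contDiff_deriv_thetaSq h.hθ)).contDiffOn)
  exact ((h1.add h2).sub h3).sub (Torus.IsSmoothSpaceTimeOn.sum fun x _ => smooth_rexp h x)

/-- **`S₁` is symmetric** (tensor products `v ⊗ v` and expansion tensors are). [folklore] -/
theorem S₁_symm (t : ℝ) (y : UnitAddTorus d) (i j : d) : D.S₁ t y i j = D.S₁ t y j i := by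
  have hsym : ∀ x, D.Sexp x t y i j = D.Sexp x t y j i := by
    intro x
    simp only [Sexp, PiLp.add_apply, Torus.euclidean_sum_apply,
      Torus.expansionTensor_symm (isSmooth_P h x) y j i, Torus.expansionTensor_symm (isSmooth_ΦB h x _) y j i,
      Torus.expansionTensor_symm (isSmooth_ΦC h x) y j i]
  simp only [S₁, PiLp.add_apply, PiLp.sub_apply, Torus.tensorProd_apply, Torus.euclidean_sum_apply, hsym]
  ring

end Smooth

/-! ## Generic linearity helpers -/

section Linear

/-- The tensor divergence of a finite sum of smooth tensor fields. [folklore] -/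
theorem tensorDivergence_finset_sum_apply {ι : Type*} (s : Finset ι)
    {A : ι → UnitAddTorus d → d → EuclideanSpace ℝ d} (hA : ∀ i ∈ s, Torus.IsSmooth (A i)) (y : UnitAddTorus d) :
    Torus.tensorDivergence (fun z j => ∑ i ∈ s, A i z j) y = ∑ i ∈ s, Torus.tensorDivergence (A i) y := by
  unfold Torus.tensorDivergence
  beta_reduce
  have hcol : ∀ j, ∀ i ∈ s, Torus.IsContDiff 1 (fun z => A i z j) := fun j i hi => ((hA i hi).column j).isContDiff (by simp)
  simp_rw [Torus.partialDeriv_finset_sum _ (hcol _)]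
  exact Finset.sum_comm

omit [DecidableEq d] in
/-- Finite sums of smooth tensor fields, summed entrywise, are smooth. [folklore] -/
theorem isSmooth_tensor_finset_sum {ι : Type*} (s : Finset ι) {A : ι → UnitAddTorus d → d → EuclideanSpace ℝ d}
    (hA : ∀ i ∈ s, Torus.IsSmooth (A i)) : Torus.IsSmooth (fun z j => ∑ i ∈ s, A i z j) :=
  Torus.isSmooth_tensor fun j => Torus.isSmooth_finset_sum s fun i hi => (hA i hi).column j

omit [DecidableEq d] in
/-- The gradient of a finite sum of smooth scalars. [folklore] -/
theorem gradient_finset_sum_apply {ι : Type*} (s : Finset ι) {f : ι → UnitAddTorus d → ℝ}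
    (hf : ∀ i ∈ s, Torus.IsSmooth (f i)) (y : UnitAddTorus d) :
    Torus.gradient (fun z => ∑ i ∈ s, f i z) y = ∑ i ∈ s, Torus.gradient (f i) y := by
  classical
  induction s using Finset.induction_on with
  | empty => simp
  | insert a s ha ih =>
    have hs : Torus.IsSmooth (fun z => ∑ i ∈ s, f i z) := Torus.isSmooth_finset_sum s fun i hi => hf i (Finset.mem_insert_of_mem hi)
    simp_rw [Finset.sum_insert ha]
    rw [Torus.gradient_add_apply ((hf a (Finset.mem_insert_self a s)).isContDiff (by simp)) (hs.isContDiff (by simp)),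
      ih fun i hi => hf i (Finset.mem_insert_of_mem hi)]

omit [DecidableEq d] in
/-- The gradient of a difference of smooth scalars. [folklore] -/
theorem gradient_sub_apply {f g : UnitAddTorus d → ℝ} (hf : Torus.IsSmooth f) (hg : Torus.IsSmooth g) (y : UnitAddTorus d) :
    Torus.gradient (fun z => f z - g z) y = Torus.gradient f y - Torus.gradient g y := by
  have hg' : Torus.IsSmooth (fun z => (-1 : ℝ) * g z) := contDiff_const.mul hg
  have e : (fun z => f z - g z) = fun z => f z + (fun z => (-1 : ℝ) * g z) z := by funext z; ring
  rw [e, Torus.gradient_add_apply (hf.isContDiff (by simp)) (hg'.isContDiff (by simp)),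
    Torus.gradient_const_mul_apply (hg.isContDiff (by simp)), neg_one_smul, sub_eq_add_neg]

/-- `div (∑_x c_x k_x ⊗ k_x) = ∑_x ((k_x·∇)c_x) k_x` for smooth scalars `c_x`. [folklore] -/
theorem tensorDivergence_sum_smul_dir (s : Finset (Index d)) {c : Index d → UnitAddTorus d → ℝ}
    (hc : ∀ x ∈ s, Torus.IsSmooth (c x)) (y : UnitAddTorus d) :
    Torus.tensorDivergence (fun z j => ∑ x ∈ s, (c x z * ((dir x j : ℤ) : ℝ)) • dirVec x) y =
      ∑ x ∈ s, dirD x (c x) y • dirVec x := by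
  have hck : ∀ x ∈ s, ∀ j, Torus.IsSmooth (fun z => c x z * ((dir x j : ℤ) : ℝ)) := fun x hx j =>
    (hc x hx).mul (Torus.isSmooth_const _)
  have hA : ∀ x ∈ s, Torus.IsSmooth (fun z j => (c x z * ((dir x j : ℤ) : ℝ)) • dirVec x) := fun x hx =>
    contDiff_pi.2 fun j => (hck x hx j).smul' (Torus.isSmooth_const _)
  rw [tensorDivergence_finset_sum_apply s hA y]
  refine Finset.sum_congr rfl fun x hx => ?_
  unfold Torus.tensorDivergence
  have h1 : ∀ j, Torus.IsContDiff 1 (fun z => c x z * ((dir x j : ℤ) : ℝ)) := fun j => (hck x hx j).isContDiff (by simp)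
  simp_rw [Torus.partialDeriv_smul' (h1 _) (Torus.isContDiff_const _), Torus.partialDeriv_const_apply, smul_zero, add_zero]
  rw [← Finset.sum_smul]
  congr 1
  simp only [dirD]
  refine Finset.sum_congr rfl fun j _ => ?_
  rw [Torus.partialDeriv_mul ((hc x hx).isContDiff (by simp)) (Torus.isContDiff_const _), Torus.partialDeriv_const_apply]
  ring

end Linear

/-! ## The sub-identities at a fixed time -/

section Pieces

variable {D} (h : D.Valid) {t : ℝ} (ht : t ∈ Icc 0 D.T)
include h ht

omit ht in
/-- `∂ₗP_x(y) = σ⁻¹(∂ₗφ_x)(σ•y)`. [folklore] -/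
theorem partialDeriv_P (x : Index d) (l : d) (y : UnitAddTorus d) :
    Torus.partialDeriv l (D.P x) y = ((D.σ : ℝ))⁻¹ * Torus.partialDeriv l (phi x D.μ) (D.σ • y) :=
  partialDeriv_phiR x h.hμ h.hσ l y

omit ht in
/-- `ΔP_x = ψ_x(σ·)`. [folklore] -/
theorem laplacian_P (x : Index d) (y : UnitAddTorus d) : Torus.laplacian (D.P x) y = D.Ψ x y := laplacian_phiR x h.hμ h.hσ y

omit ht in
/-- `ΔΦ^B_{x,j} = ∂ⱼP_x`. [folklore] -/
theorem laplacian_ΦB (x : Index d) (j : d) (y : UnitAddTorus d) :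
    Torus.laplacian (D.ΦB x j) y = Torus.partialDeriv j (D.P x) y := laplacian_thetaR x h.hμ h.hσ j y

omit ht in
/-- `ΔΦ^C_x = ψ_x(σ·)² - 1`. [folklore] -/
theorem laplacian_ΦC (x : Index d) (y : UnitAddTorus d) : Torus.laplacian (D.ΦC x) y = D.Ψ x y ^ 2 - 1 :=
  laplacian_oscPot h.hd x h.hμ h.hσ y

omit ht in
/-- `(k_x·∇)P_x = 0`. [folklore] -/
theorem dirD_P (x : Index d) (y : UnitAddTorus d) : dirD x (D.P x) y = 0 := by
  simp only [dirD, partialDeriv_P h]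
  calc ∑ j, ((dir x j : ℤ) : ℝ) * (((D.σ : ℝ))⁻¹ * Torus.partialDeriv j (phi x D.μ) (D.σ • y))
      = ((D.σ : ℝ))⁻¹ * ∑ j, ((dir x j : ℤ) : ℝ) * Torus.partialDeriv j (phi x D.μ) (D.σ • y) := by
        rw [Finset.mul_sum]; exact Finset.sum_congr rfl fun j _ => by ring
    _ = ((D.σ : ℝ))⁻¹ * dirD x (phi x D.μ) (D.σ • y) := rfl
    _ = 0 := by rw [dirD_phi x h.hμ, mul_zero]

omit ht in
/-- `∑ⱼ (k_x)ⱼ (∇ã_x)ⱼ = (k_x·∇)ã_x`. [folklore] -/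
theorem sum_dir_mul_gradA (x : Index d) {s : ℝ} (hs : s ∈ Icc 0 D.T) (y : UnitAddTorus d) :
    ∑ j, ((dir x j : ℤ) : ℝ) * D.gradA x s y j = dirD x (D.atil x s) y := by
  simp only [dirD, gradA_apply h x hs]

/-! ### `w^{(p)} ⊗ w^{(p)}` and its divergence -/

omit ht in
/-- **Time-disjointness kills all cross terms**:
`w^{(p)} ⊗ w^{(p)} = ∑_x (G_xã_x)² ψ_x(σ·)² k_x ⊗ k_x` (CL22: `R_far = 0` in this variant). [cite: CheskidovLuo2022, §4.5 Lemma 4.5] -/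
theorem tensorProd_wp (y : UnitAddTorus d) (j : d) :
    Torus.tensorProd (D.wp t) (D.wp t) y j =
      ∑ x, ((D.G x t * D.atil x t y) ^ 2 * D.Ψ x y ^ 2 * ((dir x j : ℤ) : ℝ)) • dirVec x := by
  set a : Index d → ℝ := fun x => D.G x t * D.atil x t y * D.Ψ x y with ha
  have hzero : ∀ x x', x ≠ x' → a x * a x' = 0 := by
    intro x x' hxx'
    rw [ha]
    calc D.G x t * D.atil x t y * D.Ψ x y * (D.G x' t * D.atil x' t y * D.Ψ x' y)
        = (D.G x t * D.G x' t) * (D.atil x t y * D.Ψ x y * D.atil x' t y * D.Ψ x' y) := by ring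
      _ = 0 := by rw [G_mul_G h hxx', zero_mul]
  have hwp : D.wp t y = ∑ x, a x • dirVec x := rfl
  have hwpj : D.wp t y j = ∑ x, a x * ((dir x j : ℤ) : ℝ) := by
    rw [hwp, Torus.euclidean_sum_apply]
    simp [dirVec]
  rw [Torus.tensorProd, hwpj, hwp, Finset.sum_smul]
  refine Finset.sum_congr rfl fun x _ => ?_
  rw [Finset.smul_sum, Finset.sum_eq_single x]
  · rw [smul_smul, ha]; congr 1; ring
  · intro x' _ hx'
    rw [smul_smul, show a x * ((dir x j : ℤ) : ℝ) * a x' = ((dir x j : ℤ) : ℝ) * (a x * a x') by ring,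
      hzero x x' (Ne.symm hx'), mul_zero, zero_smul]
  · intro hx; exact absurd (Finset.mem_univ x) hx

/-- **`div (w^{(p)} ⊗ w^{(p)}) = ∑_x G_x² ψ_x(σ·)² ((k_x·∇)ã_x²) k_x`** (`(k_x·∇)ψ_x = 0`;
CL22 Thm. 4.3 (1): `div(𝐖_k ⊗ 𝐖_k) = 0`). [cite: CheskidovLuo2022, §4.5 (4.21)] -/
theorem tensorDivergence_tensorProd_wp (y : UnitAddTorus d) :
    Torus.tensorDivergence (Torus.tensorProd (D.wp t) (D.wp t)) y =
      ∑ x, (D.G x t ^ 2 * D.Ψ x y ^ 2 * dirD x (fun z => D.atil x t z ^ 2) y) • dirVec x := by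
  have e : Torus.tensorProd (D.wp t) (D.wp t) = fun z j => ∑ x ∈ Finset.univ, ((D.G x t * D.atil x t z) ^ 2 * D.Ψ x z ^ 2 *
      ((dir x j : ℤ) : ℝ)) • dirVec x := by
    funext z j; exact tensorProd_wp h z j
  have hc : ∀ x ∈ Finset.univ, Torus.IsSmooth (fun z => (D.G x t * D.atil x t z) ^ 2 * D.Ψ x z ^ 2) := fun x _ =>
    (((isSmooth_atil h x ht).smul (D.G x t)).pow 2).mul ((isSmooth_Ψ h x).pow 2)
  rw [e, tensorDivergence_sum_smul_dir Finset.univ (c := fun x z => (D.G x t * D.atil x t z) ^ 2 * D.Ψ x z ^ 2) hc y]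
  refine Finset.sum_congr rfl fun x _ => ?_
  congr 1
  have ha2 : Torus.IsSmooth (fun z => D.atil x t z ^ 2) := (isSmooth_atil h x ht).pow 2
  have hΨ2s : Torus.IsSmooth (fun z => D.Ψ x z ^ 2) := (isSmooth_Ψ h x).pow 2
  have hps : Torus.IsSmooth (fun z => (fun z => D.atil x t z ^ 2) z * (fun z => D.Ψ x z ^ 2) z) := ha2.mul hΨ2s
  have ha1 : Torus.IsContDiff 1 (fun z => D.atil x t z ^ 2) := ha2.isContDiff (by simp)
  have hΨ1 : Torus.IsContDiff 1 (D.Ψ x) := (isSmooth_Ψ h x).isContDiff (by simp)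
  have hΨ2 : Torus.IsContDiff 1 (fun z => D.Ψ x z ^ 2) := hΨ2s.isContDiff (by simp)
  have e2 : (fun z => (D.G x t * D.atil x t z) ^ 2 * D.Ψ x z ^ 2) = fun z => D.G x t ^ 2 * ((fun z => D.atil x t z ^ 2) z * (fun z => D.Ψ x z ^ 2) z) := by
    funext z; ring
  have hsq : dirD x (fun z => D.Ψ x z ^ 2) y = 0 := by
    have : (fun z => D.Ψ x z ^ 2) = fun z => D.Ψ x z * D.Ψ x z := by funext z; ring
    rw [this, dirD_mul x hΨ1 hΨ1, show dirD x (D.Ψ x) y = 0 from dirD_psiR x h.hμ D.σ y]; ring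
  rw [e2, dirD_const_mul x (hps.isContDiff (by simp)), dirD_mul x ha1 hΨ2, hsq, mul_zero, zero_add]
  ring

/-- `div B̂_x = ((k_x·∇)â_x²) k_x`. [folklore] -/
theorem tensorDivergence_Bten (x : Index d) (y : UnitAddTorus d) :
    Torus.tensorDivergence (D.Bten x t) y = dirD x (D.Bsc x t) y • dirVec x := by
  have hB : Torus.IsSmooth (D.Bsc x t) := (smooth_Bsc h x).isSmooth_slice ht
  have := tensorDivergence_sum_smul_dir {x} (c := fun _ => D.Bsc x t) (fun _ _ => hB) y
  show Torus.tensorDivergence (fun z j => (D.Bsc x t z * ((dir x j : ℤ) : ℝ)) • dirVec x) y = _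
  simpa using this

/-- `(k_x·∇)ã_x² = θ² (k_x·∇)â_x²`. [folklore] -/
theorem dirD_atil_sq (x : Index d) (y : UnitAddTorus d) :
    dirD x (fun z => D.atil x t z ^ 2) y = D.θ t ^ 2 * dirD x (D.Bsc x t) y := by
  have hB : Torus.IsSmooth (D.Bsc x t) := (smooth_Bsc h x).isSmooth_slice ht
  have e : (fun z => D.atil x t z ^ 2) = fun z => D.θ t ^ 2 * D.Bsc x t z := by
    funext z; simp only [atil, Bsc, ahat]; ring
  rw [e, dirD_const_mul x (hB.isContDiff (by simp))]

/-- **Lemma 4.4, tensor form**: `∑_x B̂_x = ρ Id - R` at symmetric `R(t,y)` (column `j`: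
`∑_x â_x²(k_x)ⱼ k_x = ρ eⱼ - R eⱼ`). [cite: CheskidovLuo2022, §4.4 Lemma 4.4] -/
theorem sum_Bten (y : UnitAddTorus d) (j : d) :
    ∑ x, D.Bten x t y j = divisor D.γ₀ D.R t y • EuclideanSpace.single j 1 - D.R t y j := by
  ext i
  rw [Torus.euclidean_sum_apply]
  have key := sum_amp_sq_mul_dir (γ₀ := D.γ₀) h.hd h.hγ (h.hRsym t ht y) i j
  have e1 : ∀ x, D.Bten x t y j i = amp D.γ₀ D.R x t y ^ 2 * (((dir x i : ℤ) : ℝ) * ((dir x j : ℤ) : ℝ)) := by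
    intro x; simp [Bten, Bsc, ahat, dirVec]; ring
  simp_rw [e1]
  rw [key]
  by_cases hij : i = j
  · subst hij; simp
  · simp [hij]

/-- `∑_x div B̂_x = ∇ρ - div R`. [cite: CheskidovLuo2022, §4.4 Lemma 4.4] -/
theorem sum_tensorDivergence_Bten (y : UnitAddTorus d) :
    ∑ x, Torus.tensorDivergence (D.Bten x t) y = Torus.gradient (divisor D.γ₀ D.R t) y - Torus.tensorDivergence (D.R t) y := by
  have hρ : Torus.IsSmooth (divisor D.γ₀ D.R t) := (isSmoothSpaceTimeOn_divisor h.hR).isSmooth_slice ht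
  have hR : Torus.IsSmooth (D.R t) := h.hR.isSmooth_slice ht
  have hB : ∀ x ∈ Finset.univ, Torus.IsSmooth (D.Bten x t) := fun x _ => isSmooth_Bten h x ht
  rw [← tensorDivergence_finset_sum_apply _ hB]
  have e : (fun z j => ∑ x ∈ Finset.univ, D.Bten x t z j) =
      fun z j => (fun z j => divisor D.γ₀ D.R t z • EuclideanSpace.single j (1 : ℝ)) z j - D.R t z j := by
    funext z j; exact sum_Bten h ht z j
  have hρI : Torus.IsSmooth (fun z (j : d) => divisor D.γ₀ D.R t z • EuclideanSpace.single j (1 : ℝ)) :=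
    Torus.isSmooth_tensor fun j => hρ.smul' (Torus.isSmooth_const _)
  rw [e, Torus.tensorDivergence_sub hρI hR, Torus.tensorDivergence_smul_single (hρ.isContDiff (by simp))]

omit h in
/-- `θ² div R = div R` (the stress vanishes at every time where `θ ≠ 1`). [cite: CheskidovLuo2022, §4.4 Lemma 4.4] -/
theorem thetaSq_smul_tensorDivergence_R (hRθ : ∀ s ∈ Icc 0 D.T, D.θ s ≠ 1 → ∀ y, D.R s y = 0) (y : UnitAddTorus d) :
    D.θ t ^ 2 • Torus.tensorDivergence (D.R t) y = Torus.tensorDivergence (D.R t) y := by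
  by_cases h1 : D.θ t = 1
  · rw [h1, one_pow, one_smul]
  · have hR0 : D.R t = fun _ _ => 0 := by funext z j; rw [hRθ t ht h1 z]; rfl
    rw [hR0, Torus.tensorDivergence_zero, smul_zero]

/-! ### The expansion atoms -/

/-- Slices of `c^A_x`. [folklore] -/
theorem isSmooth_cA (x : Index d) : Torus.IsSmooth (D.cA x t) := (smooth_cA h x).isSmooth_slice ht

/-- Slices of `c^B_{x,j}`. [folklore] -/
theorem isSmooth_cB (x : Index d) (j : d) : Torus.IsSmooth (D.cB x t j) := (smooth_cB h x j).isSmooth_slice ht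

/-- Slices of `c^C_x`. [folklore] -/
theorem isSmooth_cC (x : Index d) : Torus.IsSmooth (D.cC x t) := (smooth_cC h x).isSmooth_slice ht

/-- Atom `A`: `G_x'ã_xψ_x(σ·)k_x = (ΔP_x) c^A_x = div S^A - ∇π^A - r^A`. [folklore] -/
theorem atomA (x : Index d) (y : UnitAddTorus d) :
    (D.dG x t * D.atil x t y * D.Ψ x y) • dirVec x =
      Torus.tensorDivergence (Torus.expansionTensor (D.cA x t) (D.P x)) y -
        Torus.gradient (Torus.expansionPressure (D.cA x t) (D.P x)) y - Torus.expansionRemainder (D.cA x t) (D.P x) y := by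
  rw [← Torus.laplacian_smul_eq_expansion' (isSmooth_cA h ht x) (isSmooth_P h x) y, laplacian_P h, cA, smul_smul]
  congr 1
  ring

/-- **The remainder of atom `A`**: `r^A = G_x'((∇P_x·∇ã_x) k_x + ((k_x·∇)ã_x) ∇P_x)`
(`(k_x·∇)P_x = 0` kills the third term). [folklore] -/
theorem expansionRemainder_cA (x : Index d) (y : UnitAddTorus d) :
    Torus.expansionRemainder (D.cA x t) (D.P x) y =
      D.dG x t • ((∑ j, Torus.partialDeriv j (D.P x) y * D.gradA x t y j) • dirVec x + dirD x (D.atil x t) y • Torus.gradient (D.P x) y) := by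
  have ha := isSmooth_atil h x ht
  have ha1 : Torus.IsContDiff 1 (D.atil x t) := ha.isContDiff (by simp)
  have hP := isSmooth_P h x
  have hP1 : Torus.IsContDiff 1 (D.P x) := hP.isContDiff (by simp)
  -- derivatives of `c^A = (G'ã) k`
  have hga : Torus.IsContDiff 1 (fun z => D.dG x t * D.atil x t z) := (ha.smul (D.dG x t)).isContDiff (by simp)
  have hdc : ∀ j, Torus.partialDeriv j (D.cA x t) y = (D.dG x t * Torus.partialDeriv j (D.atil x t) y) • dirVec x := by
    intro j
    show Torus.partialDeriv j (fun z => (D.dG x t * D.atil x t z) • dirVec x) y = _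
    rw [Torus.partialDeriv_smul' hga (Torus.isContDiff_const _), Torus.partialDeriv_const_apply, smul_zero, add_zero,
      Torus.partialDeriv_const_mul_apply ha1]
  have hcomp : ∀ j, (fun z => D.cA x t z j) = fun z => (D.dG x t * ((dir x j : ℤ) : ℝ)) * D.atil x t z := by
    intro j; funext z; simp [cA, dirVec]; ring
  have hdiv : Torus.divergence (D.cA x t) y = D.dG x t * dirD x (D.atil x t) y := by
    simp only [Torus.divergence, hcomp, Torus.partialDeriv_const_mul_apply ha1, dirD, Finset.mul_sum]
    exact Finset.sum_congr rfl fun j _ => by ring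
  have hgradc : ∀ j, Torus.gradient (fun z => D.cA x t z j) y = (D.dG x t * ((dir x j : ℤ) : ℝ)) • D.gradA x t y := by
    intro j; rw [hcomp j, Torus.gradient_const_mul_apply ha1]; rfl
  have hthird : ∑ j, Torus.gradient (D.P x) y j • Torus.gradient (fun z => D.cA x t z j) y = 0 := by
    simp_rw [hgradc, smul_smul, ← Finset.sum_smul]
    have : ∑ j, Torus.gradient (D.P x) y j * (D.dG x t * ((dir x j : ℤ) : ℝ)) = D.dG x t * dirD x (D.P x) y := by
      simp only [dirD, Torus.gradient_apply hP1, Finset.mul_sum]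
      exact Finset.sum_congr rfl fun j _ => by ring
    rw [this, dirD_P h x y, mul_zero, zero_smul]
  unfold Torus.expansionRemainder
  rw [hthird, sub_zero, hdiv]
  simp_rw [hdc, smul_smul, ← Finset.sum_smul]
  rw [smul_add, smul_smul, smul_smul, gradA]
  congr 1
  congr 1
  rw [Finset.mul_sum]
  refine Finset.sum_congr rfl fun j _ => ?_
  rw [Torus.gradient_apply ha1]; ring

/-- **Atom `A` meets the corrector**: `G_x'Ω̃_x[∇ã_x] - r^A_x = -2G_x'((k_x·∇)ã_x) ∇P_x`. [folklore] -/
theorem dG_smul_omegaApply_sub_remainder (x : Index d) (y : UnitAddTorus d) :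
    D.dG x t • D.omegaApply x y (D.gradA x t y) - Torus.expansionRemainder (D.cA x t) (D.P x) y =
      (-2 * D.dG x t * dirD x (D.atil x t) y) • Torus.gradient (D.P x) y := by
  rw [expansionRemainder_cA h ht x y, omegaApply, sum_dir_mul_gradA h x ht y, ← smul_sub]
  rw [show ∀ (a b c : EuclideanSpace ℝ d), (a - b) - (a + c) = -(b + c) from fun a b c => by abel]
  rw [smul_neg, ← two_smul ℝ (dirD x (D.atil x t) y • Torus.gradient (D.P x) y), smul_smul, smul_smul, ← neg_smul]
  congr 1; ring

omit ht in
/-- **The second layer**: `-2G_x'((k_x·∇)ã_x)∇P_x = ∑ⱼ (ΔΦ^B_{x,j}) c^B_{x,j}` (`ΔΦ^B_j = ∂ⱼP_x`). [folklore] -/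
theorem secondLayer (x : Index d) (y : UnitAddTorus d) :
    (-2 * D.dG x t * dirD x (D.atil x t) y) • Torus.gradient (D.P x) y =
      ∑ j, Torus.laplacian (D.ΦB x j) y • D.cB x t j y := by
  have hP1 : Torus.IsContDiff 1 (D.P x) := (isSmooth_P h x).isContDiff (by simp)
  simp only [cB, laplacian_ΦB h, smul_smul]
  rw [Torus.gradient_eq_sum_partialDeriv hP1, Finset.smul_sum]
  refine Finset.sum_congr rfl fun j _ => ?_
  rw [smul_smul]; congr 1; ring

/-- Atoms `B`: `(ΔΦ^B_{x,j}) c^B_{x,j} = div S^B - ∇π^B - r^B`. [folklore] -/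
theorem atomB (x : Index d) (j : d) (y : UnitAddTorus d) :
    Torus.laplacian (D.ΦB x j) y • D.cB x t j y =
      Torus.tensorDivergence (Torus.expansionTensor (D.cB x t j) (D.ΦB x j)) y -
        Torus.gradient (Torus.expansionPressure (D.cB x t j) (D.ΦB x j)) y - Torus.expansionRemainder (D.cB x t j) (D.ΦB x j) y :=
  Torus.laplacian_smul_eq_expansion' (isSmooth_cB h ht x j) (isSmooth_ΦB h x j) y

/-- Atom `C` (the oscillation term): `G_x²(ψ_x(σ·)² - 1)((k_x·∇)ã_x²)k_x = (ΔΦ^C_x) c^C_x = div S^C - ∇π^C - r^C`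
(CL22 (4.22) with `Δ⁻¹` in place of `𝓑`). [cite: CheskidovLuo2022, §4.5 (4.22)] -/
theorem atomC (x : Index d) (y : UnitAddTorus d) :
    (D.G x t ^ 2 * (D.Ψ x y ^ 2 - 1) * dirD x (fun z => D.atil x t z ^ 2) y) • dirVec x =
      Torus.tensorDivergence (Torus.expansionTensor (D.cC x t) (D.ΦC x)) y -
        Torus.gradient (Torus.expansionPressure (D.cC x t) (D.ΦC x)) y - Torus.expansionRemainder (D.cC x t) (D.ΦC x) y := by
  rw [← Torus.laplacian_smul_eq_expansion' (isSmooth_cC h ht x) (isSmooth_ΦC h x) y, laplacian_ΦC h, cC, smul_smul]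
  congr 1
  ring

end Pieces

/-! ## The momentum identity -/

section Main

variable {D} (h : D.Valid)
include h

/-- Slices of `Sexp_x`, `S₁` pieces are smooth. [folklore] -/
theorem isSmooth_Sexp (x : Index d) {t : ℝ} (ht : t ∈ Icc 0 D.T) : Torus.IsSmooth (D.Sexp x t) := (smooth_Sexp h x).isSmooth_slice ht

/-- **The momentum identity** (CL22 Lemma 4.5 + the linear part of Lemma 4.6, in the form consumed by
`IsNSReynoldsOn.perturb`): on `[0, T] × 𝕋^d`,
`∂ₜw + div (w ⊗ w) + div R = div S₁ + ∇qq + ff`, provided the old stress vanishes at every time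
where `θ ≠ 1` (`θ²R = R`, CL22 Lemma 4.4: "`Supp R̄ ⊂ {θ = 1}`"). [cite: CheskidovLuo2022, §4.5 Lemma 4.5] -/
theorem momentum_identity (hRθ : ∀ s ∈ Icc 0 D.T, D.θ s ≠ 1 → ∀ y, D.R s y = 0)
    {t : ℝ} (ht : t ∈ Icc 0 D.T) (y : UnitAddTorus d) :
    Torus.timeDerivWithin (Icc 0 D.T) D.w t y + Torus.tensorDivergence (Torus.tensorProd (D.w t) (D.w t)) y +
        Torus.tensorDivergence (D.R t) y =
      Torus.tensorDivergence (D.S₁ t) y + Torus.gradient (D.qq t) y + D.ff t y := by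
  -- smoothness of the slices
  have hw : Torus.IsSmooth (D.w t) := (smooth_w h).isSmooth_slice ht
  have hwp : Torus.IsSmooth (D.wp t) := (smooth_wp h).isSmooth_slice ht
  have hρ : Torus.IsSmooth (divisor D.γ₀ D.R t) := (isSmoothSpaceTimeOn_divisor h.hR).isSmooth_slice ht
  have hq : ∀ x, Torus.IsSmooth (D.qhat x t) := fun x => isSmooth_qhat h x ht
  have h1s : ∀ {f : UnitAddTorus d → ℝ}, Torus.IsSmooth f → Torus.IsContDiff 1 f := fun hf => hf.isContDiff (by simp)
  have h1t : ∀ {f : UnitAddTorus d → d → EuclideanSpace ℝ d}, Torus.IsSmooth f → Torus.IsContDiff 1 f :=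
    fun hf => hf.isContDiff (by simp)
  -- the atoms at `(t, y)`
  set T1 : Index d → EuclideanSpace ℝ d := fun x => (D.dG x t * D.atil x t y * D.Ψ x y) • dirVec x with hT1
  set F1 : Index d → EuclideanSpace ℝ d := fun x =>
    (D.G x t * Torus.timeDerivWithin (Icc 0 D.T) (D.atil x) t y * D.Ψ x y) • dirVec x with hF1
  set F2 : Index d → EuclideanSpace ℝ d := fun x =>
    D.G x t • D.omegaApply x y (Torus.timeDerivWithin (Icc 0 D.T) (D.gradA x) t y) with hF2
  set T2 : Index d → EuclideanSpace ℝ d := fun x => D.dG x t • D.omegaApply x y (D.gradA x t y) with hT2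
  set T3 : Index d → EuclideanSpace ℝ d := fun x => ((D.G x t ^ 2 - 1) * D.θ t ^ 2) • D.Z x t y with hT3
  set F3 : Index d → EuclideanSpace ℝ d := fun x => (D.H x t * D.θ t ^ 2) • Torus.timeDerivWithin (Icc 0 D.T) (D.Z x) t y +
    (D.H x t * deriv (fun s => D.θ s ^ 2) t) • D.Z x t y with hF3
  set M1 : Index d → EuclideanSpace ℝ d := fun x => ((D.G x t ^ 2 - 1) * D.θ t ^ 2) • Torus.tensorDivergence (D.Bten x t) y with hM1
  set Qx : Index d → EuclideanSpace ℝ d := fun x => ((D.G x t ^ 2 - 1) * D.θ t ^ 2) • Torus.gradient (D.qhat x t) y with hQx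
  set O : Index d → EuclideanSpace ℝ d := fun x =>
    (D.G x t ^ 2 * (D.Ψ x y ^ 2 - 1) * dirD x (fun z => D.atil x t z ^ 2) y) • dirVec x with hO
  set SA : Index d → EuclideanSpace ℝ d := fun x => Torus.tensorDivergence (Torus.expansionTensor (D.cA x t) (D.P x)) y with hSA
  set πA : Index d → EuclideanSpace ℝ d := fun x => Torus.gradient (Torus.expansionPressure (D.cA x t) (D.P x)) y with hπA
  set rA : Index d → EuclideanSpace ℝ d := fun x => Torus.expansionRemainder (D.cA x t) (D.P x) y with hrA
  set SB : Index d → EuclideanSpace ℝ d := fun x => ∑ j, Torus.tensorDivergence (Torus.expansionTensor (D.cB x t j) (D.ΦB x j)) y with hSB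
  set πB : Index d → EuclideanSpace ℝ d := fun x => ∑ j, Torus.gradient (Torus.expansionPressure (D.cB x t j) (D.ΦB x j)) y with hπB
  set rB : Index d → EuclideanSpace ℝ d := fun x => ∑ j, Torus.expansionRemainder (D.cB x t j) (D.ΦB x j) y with hrB
  set SC : Index d → EuclideanSpace ℝ d := fun x => Torus.tensorDivergence (Torus.expansionTensor (D.cC x t) (D.ΦC x)) y with hSC
  set πC : Index d → EuclideanSpace ℝ d := fun x => Torus.gradient (Torus.expansionPressure (D.cC x t) (D.ΦC x)) y with hπC
  set rC : Index d → EuclideanSpace ℝ d := fun x => Torus.expansionRemainder (D.cC x t) (D.ΦC x) y with hrC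
  set C₁ : UnitAddTorus d → d → EuclideanSpace ℝ d :=
    fun z j => Torus.tensorProd (D.w t) (D.w t) z j - Torus.tensorProd (D.wp t) (D.wp t) z j with hC₁
  set Gρ : EuclideanSpace ℝ d := Torus.gradient (fun z => D.θ t ^ 2 * divisor D.γ₀ D.R t z) y with hGρ
  set DR : EuclideanSpace ℝ d := Torus.tensorDivergence (D.R t) y with hDR
  -- (i) the time derivative
  have e1p : Torus.timeDerivWithin (Icc 0 D.T) D.wp t y = ∑ x, T1 x + ∑ x, F1 x := by
    rw [timeDerivWithin_wp h ht, ← Finset.sum_add_distrib]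
    refine Finset.sum_congr rfl fun x _ => ?_
    rw [hT1, hF1]
    beta_reduce
    rw [← add_smul, ← add_mul]
  have e1c : Torus.timeDerivWithin (Icc 0 D.T) D.wc t y = ∑ x, F2 x + ∑ x, T2 x := by
    rw [timeDerivWithin_wc h ht, ← Finset.sum_add_distrib]
  have e1t : Torus.timeDerivWithin (Icc 0 D.T) D.wt t y = -(∑ x, T3 x + ∑ x, F3 x) := by
    rw [timeDerivWithin_wt h ht, ← Finset.sum_add_distrib]
    congr 1
    refine Finset.sum_congr rfl fun x _ => ?_
    rw [hT3, hF3]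
    beta_reduce
    try simp only [add_smul]
    abel
  have e1 : Torus.timeDerivWithin (Icc 0 D.T) D.w t y =
      (∑ x, T1 x + ∑ x, F1 x) + (∑ x, F2 x + ∑ x, T2 x) + -(∑ x, T3 x + ∑ x, F3 x) := by
    rw [timeDerivWithin_w h ht, e1p, e1c, e1t]
  -- (ii) the quadratic term
  have hC₁s : Torus.IsSmooth C₁ := (hw.tensorProd hw).sub (hwp.tensorProd hwp)
  have e2 : Torus.tensorDivergence (Torus.tensorProd (D.w t) (D.w t)) y =
      Torus.tensorDivergence (Torus.tensorProd (D.wp t) (D.wp t)) y + Torus.tensorDivergence C₁ y := by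
    have eP : Torus.tensorProd (D.w t) (D.w t) = fun z j => Torus.tensorProd (D.wp t) (D.wp t) z j + C₁ z j := by
      funext z j; simp [hC₁]
    rw [eP, Torus.tensorDivergence_add_apply (h1t (hwp.tensorProd hwp)) (h1t hC₁s)]
  -- (iii) `div (wp ⊗ wp) = θ² ∑ div B̂ + ∑ M1 + ∑ O`
  have e3 : Torus.tensorDivergence (Torus.tensorProd (D.wp t) (D.wp t)) y =
      D.θ t ^ 2 • ∑ x, Torus.tensorDivergence (D.Bten x t) y + ∑ x, M1 x + ∑ x, O x := by
    rw [tensorDivergence_tensorProd_wp h ht, Finset.smul_sum, ← Finset.sum_add_distrib, ← Finset.sum_add_distrib]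
    refine Finset.sum_congr rfl fun x _ => ?_
    rw [hM1, hO]
    beta_reduce
    rw [tensorDivergence_Bten h ht x, smul_smul, smul_smul, ← add_smul, ← add_smul, dirD_atil_sq h ht x]
    congr 1; ring
  -- (iv) Lemma 4.4
  have e4 : D.θ t ^ 2 • ∑ x, Torus.tensorDivergence (D.Bten x t) y = Gρ - DR := by
    rw [sum_tensorDivergence_Bten h ht, smul_sub, thetaSq_smul_tensorDivergence_R ht hRθ, hGρ,
      Torus.gradient_const_mul_apply (h1s hρ)]
  -- (v) the temporal cancellation `T3 = M1 - Qx`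
  have e5 : ∑ x, T3 x = ∑ x, M1 x - ∑ x, Qx x := by
    rw [← Finset.sum_sub_distrib]
    refine Finset.sum_congr rfl fun x _ => ?_
    rw [hT3, hM1, hQx]
    beta_reduce
    rw [← smul_sub]; rfl
  -- (vi) atom A + corrector + atoms B
  have e6 : ∀ x, T1 x + T2 x = SA x - πA x + (SB x - πB x - rB x) := by
    intro x
    have hA : T1 x = SA x - πA x - rA x := atomA h ht x y
    have hL : T2 x - rA x = SB x - πB x - rB x := by
      rw [hT2, hrA, dG_smul_omegaApply_sub_remainder h ht x y, secondLayer h x y, hSB, hπB, hrB,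
        ← Finset.sum_sub_distrib, ← Finset.sum_sub_distrib]
      exact Finset.sum_congr rfl fun j _ => atomB h ht x j y
    rw [hA, ← hL]; abel
  have e6' : ∑ x, T1 x + ∑ x, T2 x = ∑ x, SA x - ∑ x, πA x + (∑ x, SB x - ∑ x, πB x - ∑ x, rB x) := by
    rw [← Finset.sum_add_distrib, Finset.sum_congr rfl fun x _ => e6 x]
    simp only [Finset.sum_add_distrib, Finset.sum_sub_distrib]
  -- (vii) atom C
  have e7 : ∑ x, O x = ∑ x, SC x - ∑ x, πC x - ∑ x, rC x := by
    rw [← Finset.sum_sub_distrib, ← Finset.sum_sub_distrib]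
    exact Finset.sum_congr rfl fun x _ => atomC h ht x y
  -- (viii) `div S₁`
  have e8 : Torus.tensorDivergence (D.S₁ t) y = Torus.tensorDivergence C₁ y + (∑ x, SA x + ∑ x, SB x + ∑ x, SC x) := by
    have hSx : ∀ x ∈ Finset.univ, Torus.IsSmooth (D.Sexp x t) := fun x _ => isSmooth_Sexp h x ht
    have eS : D.S₁ t = fun z j => C₁ z j + (fun z j => ∑ x, D.Sexp x t z j) z j := rfl
    rw [eS, Torus.tensorDivergence_add_apply (h1t hC₁s) (h1t (isSmooth_tensor_finset_sum _ hSx)),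
      tensorDivergence_finset_sum_apply _ hSx, ← Finset.sum_add_distrib, ← Finset.sum_add_distrib]
    congr 1
    refine Finset.sum_congr rfl fun x _ => ?_
    have hcA := Torus.isSmooth_expansionTensor (isSmooth_cA h ht x) (isSmooth_P h x)
    have hcB : ∀ j' ∈ Finset.univ, Torus.IsSmooth (Torus.expansionTensor (D.cB x t j') (D.ΦB x j')) := fun j' _ =>
      Torus.isSmooth_expansionTensor (isSmooth_cB h ht x j') (isSmooth_ΦB h x j')
    have hcC := Torus.isSmooth_expansionTensor (isSmooth_cC h ht x) (isSmooth_ΦC h x)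
    have eSx : D.Sexp x t = fun z j => (fun z j => Torus.expansionTensor (D.cA x t) (D.P x) z j +
        (fun z j => ∑ j', Torus.expansionTensor (D.cB x t j') (D.ΦB x j') z j) z j) z j +
          Torus.expansionTensor (D.cC x t) (D.ΦC x) z j := rfl
    have hAB : Torus.IsSmooth (fun z j => Torus.expansionTensor (D.cA x t) (D.P x) z j +
        (fun z j => ∑ j', Torus.expansionTensor (D.cB x t j') (D.ΦB x j') z j) z j) := hcA.add (isSmooth_tensor_finset_sum _ hcB)
    rw [eSx, Torus.tensorDivergence_add_apply (h1t hAB) (h1t hcC),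
      Torus.tensorDivergence_add_apply (h1t hcA) (h1t (isSmooth_tensor_finset_sum _ hcB)), tensorDivergence_finset_sum_apply _ hcB]
  -- (ix) `∇qq`
  have e9 : Torus.gradient (D.qq t) y = Gρ + ∑ x, Qx x - (∑ x, πA x + ∑ x, πB x + ∑ x, πC x) := by
    have hπx : ∀ x ∈ Finset.univ, Torus.IsSmooth (D.πexp x t) := fun x _ => (smooth_πexp h x).isSmooth_slice ht
    have hqx : ∀ x ∈ Finset.univ, Torus.IsSmooth (fun z => (D.G x t ^ 2 - 1) * D.θ t ^ 2 * D.qhat x t z) := fun x _ =>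
      contDiff_const.mul (hq x)
    have hθρ : Torus.IsSmooth (fun z => D.θ t ^ 2 * divisor D.γ₀ D.R t z) := contDiff_const.mul hρ
    have eq : D.qq t = fun z => (fun z => (fun z => D.θ t ^ 2 * divisor D.γ₀ D.R t z) z +
        (fun z => ∑ x, (D.G x t ^ 2 - 1) * D.θ t ^ 2 * D.qhat x t z) z) z - (fun z => ∑ x, D.πexp x t z) z := rfl
    have hsum1 : Torus.IsSmooth (fun z => (fun z => D.θ t ^ 2 * divisor D.γ₀ D.R t z) z +
        (fun z => ∑ x, (D.G x t ^ 2 - 1) * D.θ t ^ 2 * D.qhat x t z) z) := hθρ.add (Torus.isSmooth_finset_sum _ hqx)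
    have hsum2 : Torus.IsSmooth (fun z => ∑ x, D.πexp x t z) := Torus.isSmooth_finset_sum _ hπx
    rw [eq, gradient_sub_apply hsum1 hsum2, Torus.gradient_add_apply (h1s hθρ) (h1s (Torus.isSmooth_finset_sum _ hqx)),
      gradient_finset_sum_apply _ hqx, gradient_finset_sum_apply _ hπx, ← hGρ]
    have eQ : ∑ x, Torus.gradient (fun z => (D.G x t ^ 2 - 1) * D.θ t ^ 2 * D.qhat x t z) y = ∑ x, Qx x :=
      Finset.sum_congr rfl fun x _ => by rw [hQx, Torus.gradient_const_mul_apply (h1s (hq x))]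
    have eπ : ∑ x, Torus.gradient (D.πexp x t) y = ∑ x, πA x + ∑ x, πB x + ∑ x, πC x := by
      rw [← Finset.sum_add_distrib, ← Finset.sum_add_distrib]
      refine Finset.sum_congr rfl fun x _ => ?_
      have hcA := Torus.isSmooth_expansionPressure (isSmooth_cA h ht x) (isSmooth_P h x)
      have hcB : ∀ j' ∈ Finset.univ, Torus.IsSmooth (Torus.expansionPressure (D.cB x t j') (D.ΦB x j')) := fun j' _ =>
        Torus.isSmooth_expansionPressure (isSmooth_cB h ht x j') (isSmooth_ΦB h x j')
      have hcC := Torus.isSmooth_expansionPressure (isSmooth_cC h ht x) (isSmooth_ΦC h x)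
      have eπx : D.πexp x t = fun z => (fun z => Torus.expansionPressure (D.cA x t) (D.P x) z +
          (fun z => ∑ j', Torus.expansionPressure (D.cB x t j') (D.ΦB x j') z) z) z + Torus.expansionPressure (D.cC x t) (D.ΦC x) z := rfl
      have hAB : Torus.IsSmooth (fun z => Torus.expansionPressure (D.cA x t) (D.P x) z +
          (fun z => ∑ j', Torus.expansionPressure (D.cB x t j') (D.ΦB x j') z) z) := hcA.add (Torus.isSmooth_finset_sum _ hcB)
      rw [eπx, Torus.gradient_add_apply (h1s hAB) (h1s hcC),
        Torus.gradient_add_apply (h1s hcA) (h1s (Torus.isSmooth_finset_sum _ hcB)), gradient_finset_sum_apply _ hcB]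
    rw [eQ, eπ]
  -- (x) `ff`
  have e10 : D.ff t y = ∑ x, F1 x + ∑ x, F2 x - ∑ x, F3 x - (∑ x, rB x + ∑ x, rC x) := by
    show D.ff t y = _
    simp only [ff, rexp, hF1, hF2, hF3, hrB, hrC, Finset.sum_add_distrib]
  -- assemble
  rw [e1, e2, e3, e4, e8, e9, e10, e5, e7]
  have eT1 : ∑ x, T1 x = ∑ x, SA x - ∑ x, πA x + (∑ x, SB x - ∑ x, πB x - ∑ x, rB x) - ∑ x, T2 x :=
    eq_sub_of_add_eq e6'
  rw [eT1, hDR]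
  abel

end Main

/-! ## Vanishing where the cut-off and its derivative vanish -/

section Vanishing

variable {D}

/-- The expansion tensor of the zero coefficient vanishes. [folklore] -/
theorem expansionTensor_zero_coeff (Φ : UnitAddTorus d → ℝ) (y : UnitAddTorus d) (j : d) :
    Torus.expansionTensor (fun _ => (0 : EuclideanSpace ℝ d)) Φ y j = 0 := by
  simp [Torus.expansionTensor]

/-- The expansion remainder of the zero coefficient vanishes. [folklore] -/
theorem expansionRemainder_zero_coeff (Φ : UnitAddTorus d → ℝ) (y : UnitAddTorus d) :
    Torus.expansionRemainder (fun _ => (0 : EuclideanSpace ℝ d)) Φ y = 0 := by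
  have h1 : ∀ j, Torus.partialDeriv j (fun _ : UnitAddTorus d => (0 : EuclideanSpace ℝ d)) y = 0 := fun j =>
    Torus.partialDeriv_const_apply _ j y
  have h2 : Torus.divergence (fun _ : UnitAddTorus d => (0 : EuclideanSpace ℝ d)) y = 0 := by
    simp [Torus.divergence, Torus.partialDeriv_const_apply]
  simp [Torus.expansionRemainder, h1, h2]

/-- `c^A_x(t) = 0` where `θ(t) = 0`. [folklore] -/
theorem cA_eq_zero {t : ℝ} (hθ0 : D.θ t = 0) (x : Index d) : D.cA x t = fun _ => 0 := by
  funext y; simp [cA, atil_eq_zero hθ0]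

/-- `c^B_{x,j}(t) = 0` where `θ(t) = 0`. [folklore] -/
theorem cB_eq_zero {t : ℝ} (hθ0 : D.θ t = 0) (x : Index d) (j : d) : D.cB x t j = fun _ => 0 := by
  funext y; simp [cB, atil_eq_zero hθ0, dirD_const]

/-- `c^C_x(t) = 0` where `θ(t) = 0`. [folklore] -/
theorem cC_eq_zero {t : ℝ} (hθ0 : D.θ t = 0) (x : Index d) : D.cC x t = fun _ => 0 := by
  funext y
  have : dirD x (fun z => D.atil x t z ^ 2) y = 0 := by
    rw [atil_eq_zero hθ0]; exact dirD_const x _ y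
  simp [cC, this]

/-- `Sexp_x(t) = 0` where `θ(t) = 0`. [folklore] -/
theorem Sexp_eq_zero {t : ℝ} (hθ0 : D.θ t = 0) (x : Index d) (y : UnitAddTorus d) (j : d) : D.Sexp x t y j = 0 := by
  simp only [Sexp, cA_eq_zero hθ0, cB_eq_zero hθ0, cC_eq_zero hθ0, expansionTensor_zero_coeff, Finset.sum_const_zero, add_zero]

/-- `rexp_x(t) = 0` where `θ(t) = 0`. [folklore] -/
theorem rexp_eq_zero {t : ℝ} (hθ0 : D.θ t = 0) (x : Index d) (y : UnitAddTorus d) : D.rexp x t y = 0 := by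
  simp only [rexp, cB_eq_zero hθ0, cC_eq_zero hθ0, expansionRemainder_zero_coeff, Finset.sum_const_zero, add_zero]

/-- `w^{(p)}(t) = 0` where `θ(t) = 0`. [folklore] -/
theorem wp_eq_zero {t : ℝ} (hθ0 : D.θ t = 0) (y : UnitAddTorus d) : D.wp t y = 0 := by
  simp only [wp, atil_eq_zero hθ0]; simp

/-- **`S₁(t) = 0` where `θ(t) = 0`** (CL22 Lemma 4.6: well-preparedness of `R₁`). [cite: CheskidovLuo2022, §4.5 Lemma 4.6] -/
theorem S₁_eq_zero {t : ℝ} (hθ0 : D.θ t = 0) (y : UnitAddTorus d) : D.S₁ t y = 0 := by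
  funext j
  simp only [S₁, Torus.tensorProd, w_eq_zero hθ0, wp_eq_zero hθ0, Sexp_eq_zero hθ0, Finset.sum_const_zero]
  simp

variable (h : D.Valid)
include h

/-- **`ff(t) = 0` where `θ(t) = θ'(t) = 0`** (`t ∈ [0, T]`; CL22 Lemma 4.6). [cite: CheskidovLuo2022, §4.5 Lemma 4.6] -/
theorem ff_eq_zero {t : ℝ} (ht : t ∈ Icc 0 D.T) (hθ0 : D.θ t = 0) (hθ1 : deriv D.θ t = 0) (y : UnitAddTorus d) : D.ff t y = 0 := by
  have hsq : deriv (fun s => D.θ s ^ 2) t = 0 := by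
    have hθ : HasDerivAt D.θ (deriv D.θ t) t := (h.hθ.differentiable (by simp)).differentiableAt.hasDerivAt
    rw [(hθ.fun_pow 2).deriv, hθ0, hθ1]; simp
  simp only [ff, timeDerivWithin_atil_eq_zero h ht hθ0 hθ1, timeDerivWithin_gradA_eq_zero h ht hθ0 hθ1, omegaApply_zero,
    rexp_eq_zero hθ0, hθ0, hsq, Finset.sum_const_zero]
  simp

end Vanishing

end Datum

end CL22

end Literature.Analysis.FluidPDE
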